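import Mathlib.Data.Finset.Card
import Literature.Computability.MetaComplexity.ResLin
import Literature.Computability.MetaComplexity.ResLinProofs
import Literature.Computability.MetaComplexity.RevResLin
import HarnessLib

/-!
# Winning strategies for Res(⊕) width (Atserias–Dalmau one system up)

The two combinatorial objects behind the space–width relation for resolution over parities
Res(⊕) of Gryaznov–Ovcharov–Riazanov [ACM ToCT 2024, §4] (the relation itself, GOR Thm 6, is
`Literature/Computability/MetaComplexity/ResLinSpaceWidth.lean`):

* `IsWinningStrategy φ K H` — a `K`-WINNING STRATEGY [GOR 2024, §4, the definition before Lemma 5;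
  Atserias–Dalmau 2008, Def. 2 for resolution]: a nonempty family `H` of linear systems over `𝔽₂`
  with (1) at most `K` equations each, (2) every clause of `φ` satisfiable together with every
  member, (3) closure under semantic consequences with `≤ K` equations, (4) one-form extension below
  `K` equations; `IsWinningStrategy.empty_mem`.
* `ResLinDerivableWithin φ k C` — the clauses having a Res(⊕) derivation from `φ` (resolution rule +
  SEMANTIC weakening, `IsResLinDerivation`) all of whose lines have at most `k` linear literals (the
  set `𝒞` of the proof of [GOR 2024, Lemma 5]), as an inductive closure, with the bridge to the
  line-based format in both directions: `ResLinDerivableWithin.exists_append` /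
  `.exists_isResLinRefutation` (extraction of a line-based refutation of literal-width `≤ k`) and
  `resLinDerivableWithin_of_mem`.
* `isWinningStrategy_of_forall_lt_card` = [GOR 2024, Lemma 5]: if `φ` is an `r`-CNF, `r ≤ k`, and
  every Res(⊕) refutation of `φ` has a line with more than `k` linear literals, then the systems with
  `≤ k` equations that are satisfiable together with every clause derivable within literal-width
  `k` form a `k`-winning strategy (property (4) is one resolution step on `¬F ∨ (f = 0)`,
  `¬F ∨ (f = 1)`).

## Design notes

* A linear SYSTEM is a `Finset LinLit` (the equation `(f, b)` reads `⊕_{i∈f} xᵢ = b`); `σ` solves `F`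
  iff `∀ e ∈ F, LinLit.eval σ e = true`; the clause `¬F` is `F.image fun e => (e.1, !e.2)`.
* Literal-width of a linear clause `C : Finset LinLit` is `C.card` (GOR's `Width`); the tree's
  rank `linClauseRank C ≤ C.card` (`ResLinWidth.lean`).
* What is NOT here: GOR's Lemma 6 (the converse direction "strategy ⇒ no narrow refutation"),
  the Spoiler–Duplicator game presentation.

## References

* S. Gryaznov, S. Ovcharov, A. Riazanov, *Resolution over linear equations: combinatorial games
  for tree-like size and space*, ACM ToCT 16(3) (2024), §4, Lemma 5 [GryaznovOvcharovRiazanov2024].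
* A. Atserias, V. Dalmau, *A combinatorial characterization of resolution width*, JCSS 74 (2008),
  Def. 2, Lemma 5 [AtseriasDalmau2008].
-/

namespace Literature.Computability.MetaComplexity

open _root_.Computability Complexity

/-! ### Winning strategies (Atserias–Dalmau for Res(⊕)) -/

/-- A **`K`-winning strategy** for the (linear) CNF `φ` [Gryaznov–Ovcharov–Riazanov 2024, §4,
Def. before Lemma 5 = Atserias–Dalmau 2008, Def. 2 one system up]: a nonempty family `H` of linear
systems over `𝔽₂` (finite sets of equations `(f, b)`, read `⊕_{i∈f} xᵢ = b`) such that (1) every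
system in `H` has at most `K` equations; (2) for every `F ∈ H` and every clause `C` of `φ` some
solution of `F` satisfies `C`; (3) `H` is closed under semantic consequences with at most `K`
equations; (4) every `F ∈ H` with fewer than `K` equations extends inside `H` by `f = a` for every
linear form `f` and a suitable constant `a`. (Nonemptiness is part of GOR's definition: "a
non-empty family".) [cite: GryaznovOvcharovRiazanov2024, §4] -/
structure IsWinningStrategy (φ : CNF ℕ) (K : ℕ) (H : Set (Finset LinLit)) : Prop where
  /-- `H` is nonempty. -/
  nonempty : ∃ F, F ∈ H
  /-- (1) at most `K` equations. -/
  card_le : ∀ F ∈ H, F.card ≤ K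
  /-- (2) every clause of `φ` is satisfied by some solution of every `F ∈ H`. -/
  exists_sat : ∀ F ∈ H, ∀ c ∈ φ, ∃ σ : ℕ → Bool,
    (∀ e ∈ F, LinLit.eval σ e = true) ∧ (Clause.toLinClause c).eval σ = true
  /-- (3) closure under semantic consequences of size `≤ K`. -/
  mem_of_imp : ∀ F ∈ H, ∀ G : Finset LinLit,
    (∀ σ : ℕ → Bool, (∀ e ∈ F, LinLit.eval σ e = true) → ∀ e ∈ G, LinLit.eval σ e = true) →
    G.card ≤ K → G ∈ H
  /-- (4) extension by any linear form. -/
  exists_insert_mem : ∀ F ∈ H, F.card < K → ∀ f : Finset ℕ, ∃ a : Bool, insert (f, a) F ∈ H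

/-- The empty system belongs to every winning strategy (it is a consequence of any member).
[Gryaznov–Ovcharov–Riazanov 2024, §4 (proof of Lemma 5: "𝓗 contains the empty system")]
[cite: GryaznovOvcharovRiazanov2024, §4] -/
theorem IsWinningStrategy.empty_mem {φ : CNF ℕ} {K : ℕ} {H : Set (Finset LinLit)}
    (hH : IsWinningStrategy φ K H) : (∅ : Finset LinLit) ∈ H := by
  obtain ⟨F, hF⟩ := hH.nonempty
  exact hH.mem_of_imp F hF ∅ (by simp) (by simp)

/-! ### Clauses derivable within literal-width `k` -/

/-- `ResLinDerivableWithin φ k C`: the linear clause `C` has a Res(⊕) derivation from `φ` all of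
whose lines (including `C` and the initial clauses used) have at most `k` linear literals — the set
`𝒞 = {C₁, …, C_m}` of the proof of [Gryaznov–Ovcharov–Riazanov 2024, Lemma 5], presented as the
least set containing the narrow clauses of `φ` and closed under the two rules of Res(⊕) restricted
to conclusions with `≤ k` literals. See `ResLinDerivableWithin.exists_isResLinRefutation` /
`resLinDerivableWithin_of_mem` for the equivalence with line-based derivations
(`IsResLinDerivation`). [cite: GryaznovOvcharovRiazanov2024, Lemma 5] -/
inductive ResLinDerivableWithin (φ : CNF ℕ) (k : ℕ) : LinClause → Prop
  /-- an initial clause with at most `k` literals -/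
  | initial (c : Clause ℕ) (hc : c ∈ φ) (hk : (Clause.toLinClause c).card ≤ k) :
      ResLinDerivableWithin φ k (Clause.toLinClause c)
  /-- the resolution rule, conclusion with at most `k` literals -/
  | resolve (C D : LinClause) (f : Finset ℕ)
      (hC : ResLinDerivableWithin φ k (insert (f, false) C))
      (hD : ResLinDerivableWithin φ k (insert (f, true) D)) (hk : (C ∪ D).card ≤ k) :
      ResLinDerivableWithin φ k (C ∪ D)
  /-- the semantic weakening rule, conclusion with at most `k` literals -/
  | weaken (C D : LinClause) (hC : ResLinDerivableWithin φ k C)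
      (h : ∀ σ : ℕ → Bool, C.eval σ = true → D.eval σ = true) (hk : D.card ≤ k) :
      ResLinDerivableWithin φ k D

/-- Appending one valid line to a Res(⊕) derivation gives a derivation. [Itsykson–Sokolov 2020, §2]
[cite: ItsyksonSokolov2020, §2] -/
theorem IsResLinDerivation.append_line {φ : CNF ℕ} {π : List ResLinLine}
    (hπ : IsResLinDerivation φ π) {l : ResLinLine} (hl : IsValidResLinLine φ π l) :
    IsResLinDerivation φ (π ++ [l]) := by
  intro k hk
  rw [List.length_append, List.length_singleton] at hk
  rcases Nat.lt_succ_iff_lt_or_eq.1 hk with h | rfl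
  · rw [List.take_append_of_le_length h.le, List.getElem_append_left h]
    exact hπ k h
  · rw [List.take_append_of_le_length le_rfl, List.take_length, List.getElem_append_right le_rfl]
    simpa using hl

/-- Indexing the pivot of `A ++ x :: B` (helper). [folklore] -/
private theorem getElem_append_cons_length {α : Type*} (A B : List α) (x : α)
    (h : A.length < (A ++ x :: B).length) : (A ++ x :: B)[A.length]'h = x := by
  simp

/-- EXTRACTION: a clause derivable within literal-width `k` can be appended, together with
intermediate lines of literal-width `≤ k`, to ANY line-based derivation from `φ` (so that no
re-indexing of premises is ever needed). [Gryaznov–Ovcharov–Riazanov 2024, proof of Lemma 5 (the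
clauses `Cᵢ` "having a Res(⊕) derivation from `φ` of width at most `k`")]
[cite: GryaznovOvcharovRiazanov2024, Lemma 5] -/
theorem ResLinDerivableWithin.exists_append {φ : CNF ℕ} {k : ℕ} {C : LinClause}
    (h : ResLinDerivableWithin φ k C) :
    ∀ π₀ : List ResLinLine, IsResLinDerivation φ π₀ →
      ∃ (τ : List ResLinLine) (l : ResLinLine), l.clause = C ∧
        IsResLinDerivation φ (π₀ ++ τ ++ [l]) ∧ ∀ x ∈ τ ++ [l], x.clause.card ≤ k := by
  induction h with
  | initial c hc hk =>
      intro π₀ hπ₀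
      refine ⟨[], ⟨Clause.toLinClause c, .initial⟩, rfl, ?_, ?_⟩
      · rw [List.append_nil]
        exact hπ₀.append_line ⟨c, hc, rfl⟩
      · simpa using hk
  | resolve C D f hC hD hk ihC ihD =>
      intro π₀ hπ₀
      obtain ⟨τ₁, l₁, hl₁, hder₁, hw₁⟩ := ihC π₀ hπ₀
      obtain ⟨τ₂, l₂, hl₂, hder₂, hw₂⟩ := ihD (π₀ ++ τ₁ ++ [l₁]) hder₁
      -- indices of the two premises inside `π₂ := π₀ ++ τ₁ ++ [l₁] ++ τ₂ ++ [l₂]`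
      set π₂ := π₀ ++ τ₁ ++ [l₁] ++ τ₂ ++ [l₂] with hπ₂
      have hi : (π₀ ++ τ₁).length < π₂.length := by
        simp [hπ₂]
      have hj : (π₀ ++ τ₁ ++ [l₁] ++ τ₂).length < π₂.length := by
        simp [hπ₂]
      have hgi : (π₂[(π₀ ++ τ₁).length]'hi) = l₁ := by
        have e : π₂ = (π₀ ++ τ₁) ++ (l₁ :: (τ₂ ++ [l₂])) := by simp [hπ₂]
        rw [List.getElem_of_eq e]
        exact getElem_append_cons_length _ _ _ _
      have hgj : (π₂[(π₀ ++ τ₁ ++ [l₁] ++ τ₂).length]'hj) = l₂ := by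
        have e : π₂ = (π₀ ++ τ₁ ++ [l₁] ++ τ₂) ++ (l₂ :: []) := by simp [hπ₂]
        rw [List.getElem_of_eq e]
        exact getElem_append_cons_length _ _ _ _
      refine ⟨τ₁ ++ [l₁] ++ τ₂ ++ [l₂], ⟨C ∪ D, .resolve (π₀ ++ τ₁).length
        (π₀ ++ τ₁ ++ [l₁] ++ τ₂).length f⟩, rfl, ?_, ?_⟩
      · have e2 : π₀ ++ (τ₁ ++ [l₁] ++ τ₂ ++ [l₂]) = π₂ := by simp [hπ₂]
        rw [e2]
        refine hder₂.append_line ?_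
        exact ⟨hi, hj, C, D, by rw [hgi, hl₁], by rw [hgj, hl₂], rfl⟩
      · intro x hx
        simp only [List.append_assoc, List.mem_append, List.mem_cons, List.not_mem_nil,
          or_false] at hx hw₁ hw₂
        rcases hx with hx | rfl | hx | rfl | rfl
        · exact hw₁ x (Or.inl hx)
        · exact hw₁ _ (Or.inr rfl)
        · exact hw₂ x (Or.inl hx)
        · exact hw₂ _ (Or.inr rfl)
        · simpa using hk
  | weaken C D hC himp hk ih =>
      intro π₀ hπ₀
      obtain ⟨τ₁, l₁, hl₁, hder₁, hw₁⟩ := ih π₀ hπ₀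
      set π₁ := π₀ ++ τ₁ ++ [l₁] with hπ₁
      have hi : (π₀ ++ τ₁).length < π₁.length := by simp [hπ₁]
      have hgi : (π₁[(π₀ ++ τ₁).length]'hi) = l₁ := by
        have e : π₁ = (π₀ ++ τ₁) ++ (l₁ :: []) := by simp [hπ₁]
        rw [List.getElem_of_eq e]
        exact getElem_append_cons_length _ _ _ _
      refine ⟨τ₁ ++ [l₁], ⟨D, .weaken (π₀ ++ τ₁).length⟩, rfl, ?_, ?_⟩
      · have e1 : π₀ ++ (τ₁ ++ [l₁]) = π₁ := by simp [hπ₁]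
        rw [e1]
        refine hder₁.append_line ?_
        refine ⟨hi, fun σ hσ => himp σ ?_⟩
        rw [hgi, hl₁] at hσ
        exact hσ
      · intro x hx
        rw [List.mem_append, List.mem_singleton] at hx
        rcases hx with hx | rfl
        · exact hw₁ x hx
        · simpa using hk

/-- If the EMPTY clause is derivable within literal-width `k`, then `φ` has a line-based Res(⊕)
refutation all of whose lines have at most `k` linear literals. [Gryaznov–Ovcharov–Riazanov 2024,
proof of Lemma 5] [cite: GryaznovOvcharovRiazanov2024, Lemma 5] -/
theorem ResLinDerivableWithin.exists_isResLinRefutation {φ : CNF ℕ} {k : ℕ}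
    (h : ResLinDerivableWithin φ k ∅) :
    ∃ π : List ResLinLine, IsResLinRefutation φ π ∧ ∀ l ∈ π, l.clause.card ≤ k := by
  obtain ⟨τ, l, hl, hder, hw⟩ := h.exists_append [] (fun k hk => by simp at hk)
  refine ⟨[] ++ τ ++ [l], ⟨hder, l, by simp, hl⟩, ?_⟩
  simpa using hw

/-- Conversely, every line of a line-based derivation whose lines all have at most `k` linear
literals is derivable within literal-width `k`. [Gryaznov–Ovcharov–Riazanov 2024, proof of
Lemma 5] [cite: GryaznovOvcharovRiazanov2024, Lemma 5] -/
theorem resLinDerivableWithin_of_mem {φ : CNF ℕ} {k : ℕ} {π : List ResLinLine}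
    (hπ : IsResLinDerivation φ π) (hw : ∀ l ∈ π, l.clause.card ≤ k) :
    ∀ l ∈ π, ResLinDerivableWithin φ k l.clause := by
  -- strong induction on the position of the line
  suffices key : ∀ n, ∀ i (hi : i < π.length), i < n → ResLinDerivableWithin φ k (π[i]'hi).clause by
    intro l hl
    obtain ⟨i, hi, rfl⟩ := List.getElem_of_mem hl
    exact key (i + 1) i hi (Nat.lt_succ_self i)
  intro n
  induction n with
  | zero => intro i hi hn; exact absurd hn (Nat.not_lt_zero _)
  | succ n ih =>
      intro i hi hin
      have hvalid := hπ i hi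
      have hk : (π[i]'hi).clause.card ≤ k := hw _ (List.getElem_mem hi)
      unfold IsValidResLinLine at hvalid
      rcases hrule : (π[i]'hi).rule with _ | ⟨a, b, f⟩ | ⟨a⟩
      · rw [hrule] at hvalid
        obtain ⟨c, hc, hcl⟩ := hvalid
        rw [hcl] at hk ⊢
        exact .initial c hc hk
      · rw [hrule] at hvalid
        obtain ⟨ha, hb, C, D, hCa, hDb, hcl⟩ := hvalid
        rw [List.length_take] at ha hb
        have ha' : a < π.length := lt_of_lt_of_le ha (min_le_right _ _)
        have hb' : b < π.length := lt_of_lt_of_le hb (min_le_right _ _)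
        have hai : a < i := lt_of_lt_of_le ha (min_le_left _ _)
        have hbi : b < i := lt_of_lt_of_le hb (min_le_left _ _)
        have hA := ih a ha' (by omega)
        have hB := ih b hb' (by omega)
        rw [List.getElem_take] at hCa hDb
        rw [hCa] at hA
        rw [hDb] at hB
        rw [hcl] at hk ⊢
        exact .resolve C D f hA hB hk
      · rw [hrule] at hvalid
        obtain ⟨ha, himp⟩ := hvalid
        rw [List.length_take] at ha
        have ha' : a < π.length := lt_of_lt_of_le ha (min_le_right _ _)
        have hai : a < i := lt_of_lt_of_le ha (min_le_left _ _)
        have hA := ih a ha' (by omega)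
        rw [List.getElem_take] at himp
        exact .weaken _ _ hA himp hk

/-! ### Two semantic helpers -/

/-- Negating the constant negates the literal (local copy of `linLit_eval_not` of
`ResLinResolventImplication.lean`). [Itsykson–Sokolov 2020, §2] [cite: ItsyksonSokolov2020, §2] -/
private theorem linLit_eval_not' (σ : ℕ → Bool) (f : Finset ℕ) (b : Bool) :
    LinLit.eval σ (f, !b) = !LinLit.eval σ (f, b) := by
  cases b
  · exact LinLit.eval_true_eq_not σ f
  · have h := LinLit.eval_true_eq_not σ f
    simp only [Bool.not_true]
    rw [h, Bool.not_not]

/-- A clause with a true literal is true (helper). [folklore] -/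
private theorem linClause_eval_eq_true_of_mem' {σ : ℕ → Bool} {C : LinClause} {l : LinLit}
    (hl : l ∈ C) (h : LinLit.eval σ l = true) : C.eval σ = true := by
  unfold LinClause.eval
  simp only [decide_eq_true_eq]
  exact ⟨l, hl, h⟩

/-! ### Winning strategies from width (GOR Lemma 5) -/

/-- The translation of a clause has at most as many linear literals as the clause has literals.
[Itsykson–Sokolov 2020, §2] [cite: ItsyksonSokolov2020, §2] -/
theorem card_toLinClause_le (c : Clause ℕ) : (Clause.toLinClause c).card ≤ c.length := by
  unfold Clause.toLinClause
  exact le_trans (List.toFinset_card_le (l := c.map Literal.toLinLit)) (by rw [List.length_map])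

/-- **Winning strategies from width** [Gryaznov–Ovcharov–Riazanov 2024, Lemma 5]: if `φ` is an
`r`-CNF, `k ≥ r`, and NO Res(⊕) refutation of `φ` has all its lines of literal-width `≤ k`, then
the family of linear systems with at most `k` equations having, for every clause derivable within
literal-width `k`, a solution satisfying it, is a `k`-winning strategy.
[cite: GryaznovOvcharovRiazanov2024, Lemma 5] -/
theorem isWinningStrategy_of_forall_lt_card {φ : CNF ℕ} {r k : ℕ} (hφ : φ.IsWidthLE r)
    (hrk : r ≤ k)
    (hwide : ∀ π : List ResLinLine, IsResLinRefutation φ π → ∃ l ∈ π, k < l.clause.card) :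
    IsWinningStrategy φ k {F : Finset LinLit | F.card ≤ k ∧ ∀ C : LinClause,
      ResLinDerivableWithin φ k C →
        ∃ σ : ℕ → Bool, (∀ e ∈ F, LinLit.eval σ e = true) ∧ C.eval σ = true} := by
  -- no clause derivable within width `k` is identically false (else `∅` would be derivable)
  have hsat : ∀ C, ResLinDerivableWithin φ k C → ∃ σ : ℕ → Bool, C.eval σ = true := by
    intro C hC
    by_contra h
    push Not at h
    have hE : ResLinDerivableWithin φ k ∅ :=
      .weaken C ∅ hC (fun σ hσ => absurd hσ (h σ)) (by simp)
    obtain ⟨π, hπ, hw⟩ := hE.exists_isResLinRefutation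
    obtain ⟨l, hl, hkl⟩ := hwide π hπ
    exact absurd (hw l hl) (not_le.2 hkl)
  refine ⟨⟨∅, ?_⟩, ?_, ?_, ?_, ?_⟩
  · refine ⟨by simp, fun C hC => ?_⟩
    obtain ⟨σ, hσ⟩ := hsat C hC
    exact ⟨σ, by simp, hσ⟩
  · intro F hF
    exact hF.1
  · intro F hF c hc
    exact hF.2 _ (.initial c hc ((card_toLinClause_le c).trans ((hφ c hc).trans hrk)))
  · intro F hF G hFG hG
    refine ⟨hG, fun C hC => ?_⟩
    obtain ⟨σ, hσF, hσC⟩ := hF.2 C hC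
    exact ⟨σ, hFG σ hσF, hσC⟩
  · intro F hF hFk f
    by_contra hcon
    push Not at hcon
    -- the clause `¬F`
    set N : LinClause := F.image (fun e => (e.1, !e.2)) with hN
    have hNcard : N.card ≤ F.card := Finset.card_image_le
    -- for each `a`, the clause `¬(F ∧ (f = a)) = ¬F ∨ (f = ¬a)` is derivable within width `k`
    have hder : ∀ a : Bool, ResLinDerivableWithin φ k (insert (f, !a) N) := by
      intro a
      have hnot : ¬ ((insert (f, a) F).card ≤ k ∧ ∀ C : LinClause, ResLinDerivableWithin φ k C →
          ∃ σ : ℕ → Bool, (∀ e ∈ insert (f, a) F, LinLit.eval σ e = true) ∧ C.eval σ = true) :=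
        fun h => hcon a h
      have hcard : (insert (f, a) F).card ≤ k := (Finset.card_insert_le _ _).trans (by omega)
      rw [not_and] at hnot
      have hnot' := hnot hcard
      push Not at hnot'
      obtain ⟨C, hC, hCσ⟩ := hnot'
      refine .weaken C _ hC (fun σ hσ => ?_) ?_
      · -- `σ` satisfies `C`, hence violates some equation of `F ∧ (f = a)`
        have hviol : ∃ e ∈ insert (f, a) F, LinLit.eval σ e = false := by
          by_contra hall
          push Not at hall
          have hsol : ∀ e ∈ insert (f, a) F, LinLit.eval σ e = true := fun e he => by
            cases hev : LinLit.eval σ e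
            · exact absurd hev (hall e he)
            · rfl
          exact absurd hσ (hCσ σ hsol)
        obtain ⟨e, he, hefalse⟩ := hviol
        rcases Finset.mem_insert.1 he with rfl | he
        · apply linClause_eval_eq_true_of_mem' (Finset.mem_insert_self _ _)
          rw [linLit_eval_not', hefalse, Bool.not_false]
        · apply linClause_eval_eq_true_of_mem'
            (Finset.mem_insert_of_mem (Finset.mem_image_of_mem (fun e => (e.1, !e.2)) he))
          show LinLit.eval σ (e.1, !e.2) = true
          rw [linLit_eval_not', show (e.1, e.2) = e from rfl, hefalse, Bool.not_false]
      · exact (Finset.card_insert_le _ _).trans (by omega)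
    -- one resolution step on `f`: `¬F` is derivable within width `k`
    have hNder : ResLinDerivableWithin φ k N := by
      have h1 := hder true
      have h0 := hder false
      simp only [Bool.not_true, Bool.not_false] at h1 h0
      have h := ResLinDerivableWithin.resolve N N f h1 h0 (by rw [Finset.union_idempotent]; omega)
      rwa [Finset.union_idempotent] at h
    -- but `F` has a solution satisfying `¬F`: contradiction
    obtain ⟨σ, hσF, hσN⟩ := hF.2 N hNder
    unfold LinClause.eval at hσN
    simp only [decide_eq_true_eq] at hσN
    obtain ⟨l, hl, hltrue⟩ := hσN
    obtain ⟨e, he, rfl⟩ := Finset.mem_image.1 hl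
    rw [linLit_eval_not', show (e.1, e.2) = e from rfl, hσF e he] at hltrue
    exact absurd hltrue (by decide)

end Literature.Computability.MetaComplexity
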